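import Summits.BirchSwinnertonDyer.BirchSwinnertonDyer.Theorems.ByReductionTypeAtTwoRankOneAtTwoOffBigImageOddLocalDefs
import Summits.BirchSwinnertonDyer.BirchSwinnertonDyer.Theorems.ByReductionTypeAtTwoRankOneAtTwoOffBigImageOddLocalRegularFilterAlgebra
import Summits.BirchSwinnertonDyer.BirchSwinnertonDyer.Theorems.ByReductionTypeAtTwoRankOneAtTwoOffBigImageOddLocalEngineGoursatLift
import Summits.BirchSwinnertonDyer.BirchSwinnertonDyer.Theorems.ByReductionTypeAtTwoRankOneAtTwoOffBigImageOddLocalEngineChebotarev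
import Summits.BirchSwinnertonDyer.BirchSwinnertonDyer.Theorems.ByReductionTypeAtTwoRankOneAtTwoOffBigImageOddLocalEngineRegularLift
import Summits.BirchSwinnertonDyer.BirchSwinnertonDyer.Theorems.ByReductionTypeAtTwoRankOneAtTwoOneDoorLawCDefs
import Summits.BirchSwinnertonDyer.BirchSwinnertonDyer.Theorems.ByReductionTypeAtTwoRankOneAtTwoBigImageOddLocalOneDoorFullC
import Summits.BirchSwinnertonDyer.BirchSwinnertonDyer.Theorems.ByReductionTypeAtTwoRankOneAtTwoBigImageOddLocalOneDoorAnalyticGlue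
import Summits.BirchSwinnertonDyer.BirchSwinnertonDyer.Theorems.ByReductionTypeAtTwoRankOneAtTwoBigImageOddLocalOneDoorTamagawa
import Summits.BirchSwinnertonDyer.BirchSwinnertonDyer.Theorems.ByReductionTypeAtTwoRankOneAtTwoBigImageOddLocalOneDoorKolyvaginExactBridgeSupply
import Summits.BirchSwinnertonDyer.BirchSwinnertonDyer.Theorems.GenusKolyvaginAtTwoEquivariantChebotarevAtTwoStepB
import Summits.BirchSwinnertonDyer.BirchSwinnertonDyer.Theorems.ClassRecordThreeShimuraKolyvaginImageInputs
import Literature.NumberTheory.EllipticCurves.TwoAdicImageNonSurjectiveFamiliesProofs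
import Literature.NumberTheory.EllipticCurves.LocalTorsionMultiplicativeProofs
import Literature.NumberTheory.EllipticCurves.NonEisensteinPrimeOfSurjective
import Literature.NumberTheory.EllipticCurves.HeegnerPointsKolyvaginConjugation
import Literature.NumberTheory.EllipticCurves.BSDSelmerPConverseSerreProofs
import HarnessLib

/-!
# Route `ByReductionTypeAtTwo`, crux `RankOneAtTwoOffBigImageOddLocal` (stmt-BirchSwinnertonDyer-23716), line
# `refined_kolyvagin_tamagawa_shift_at_two` — ENGINE PORT `c₀ ↦ h₀` (regular element), §H Step B for a REGULAR element (card E2)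

Lead prover `prover-cruxlead-stmt-BirchSwinnertonDyer-23716-g0` (2026-08-28), landing the crux-plan g6 ENGINE QUARRY
`Cruxes/RankOneAtTwoOffBigImageOddLocal/RefinedKolyvaginEngineG6.lean` (planner `cruxplan-…-23716-refined-kolyvag-9ff2fe475f-g6`, v10, ≈2800 lines,
rc 0 / 0 sorry; `Cruxes/` files are not importable, so the lead COPIES the proofs into `Theorems/` — card «LEAD QUICKSTART (g6)» Q2 #3 / Q4) as
`--supports stmt-BirchSwinnertonDyer-23716` helpers, continuing `…Engine{Dictionary,Parity,Cyclotomic,CyclotomicBasis,GoursatLift,Chebotarev,RegularSupply,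
RegularLift}.lean`.  The engine port = kernel-closable item #3 of the pen's order (PEN-PICK-23716 ADD-4): Kolyvagin primes whose Frobenius is a REGULAR
element `h₀` (det `−1`, trace `0`, odd mod `2`; LOSSLESS local Kummer maps by R1/LKL) instead of complex conjugation `c₀` (which loses the top bit at
`Δ > 0`, residual 24883), with McCallum's exact local orders — the supply the line's filtered stubs `…WithOn Φ_reg Ω` consume (card #7
`regular-frobenius-kolyvagin-primes-pos-disc`).  THIS FILE: §H — `exists_orders_regular` (McCallum's simultaneous exact orders for an additive involution `A` with `A² = 1` — the regular `ρ(h₀)` — using §D's coset absorption: the constant `[c_i, k₀]` cannot destroy exact order), `inv_smul_torsionMap_eq_of_conjGal_mul_mem`, `exists_h1Eval_conj_mul_order_regular`, `conjGal_mul_mem_torsionFixing_of_smul_smul`, `mul_absGaloisRestrict_mul_smul_eq`, and `exists_galoisElement_regular_rat`: given a regular `h₀ = c₀ · res ρ₀` (module involution, inverting `μ`) produce McCallum's Galois element `ρ = ρ₀ · n` with the prescribed exact twisted orders `ord [c_i, conj(ρm)·ρm] = 2^{N_i}` — the hypothesis `hρ` of `Engine.exists_kolyvaginPrime_gt_two_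of_galoisElement_regular`.

Statements and proofs are the quarry's VERBATIM (namespace moved to `…Theorems.OffBigImageOddLocalAtTwo.Engine`).  Nothing here proves the crux,
`BSDp W 2`, BSD or the summit; no registered stub is discharged (engine inputs only).  BSD is not proved.

Refs: [GrossLMS1991] §3 (3.1)–(3.3), §9; [McCallumLMS1991] §3 (Cor. 3.2, Prop. 3.1), §5; [SilvermanAEC2009] III.7–III.8, VII–VIII; Serre (1972) §5.3.
-/

set_option linter.dupNamespace false -- tree convention: `Summit.BirchSwinnertonDyer.BirchSwinnertonDyer.Theorems` (summit = sub-problem)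
set_option autoImplicit false

noncomputable section

namespace Summit.BirchSwinnertonDyer.BirchSwinnertonDyer.Theorems.OffBigImageOddLocalAtTwo.Engine

/-! ## §H  Step B for a REGULAR element (card E2, PROVED): McCallum's Galois element `ρ = ρ₀ · n` with a constant and the twisted involution `ρ₀⁻¹ ∘ τ` -/

section StepBH

open scoped Classical
open WeierstrassCurve Field Finset
open Literature.NumberTheory.EllipticCurves
open Summit.BirchSwinnertonDyer.BirchSwinnertonDyer.Theorems.GenusExact

section StepBAlgebra

variable {T : Type*} [AddCommGroup T]

/-- **Step B targets for a regular element.**  `A` an additive involution of `T` (the action of `h₀` on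
`E[n]`, transported), `P` with `2^M P = 0` and `P + A P` of "order `2^M`" (LOSSLESS: R1/LKL), the kernel condition
`ker(A - 1) = im(A + 1)` on each `T[2^e]`, `e ≤ M` (regularity), an involution `π` of the index set with exponents
`N i ≤ e i ≤ M`, `N (π i) = N i`, and CONSTANTS `κ i ∈ T[2^{e i}]` with `A κ(π i) = κ i` (the values `[c_i, k₀]`,
`k₀ = h₀²|_{Γ_K}` — card E2 / §D).  Then there is `x : ι → T`, `2^{e i} x_i = 0`, with
`κ i + A x_{π i} + x_i` of order EXACTLY `2^{N i}` for every `i`.  (The tree's `exists_orders_of_tauStable` is the case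
`κ = 0`, `A = τ`.) -/
theorem exists_orders_regular (A : T →+ T) (hA2 : ∀ t, A (A t) = t) {M : ℕ} {P : T}
    (hPM : (2 : ℤ) ^ M • P = 0) (hP1 : M ≠ 0 → (2 : ℤ) ^ (M - 1) • (P + A P) ≠ 0)
    (hker : ∀ (e : ℕ) (t : T), e ≤ M → (2 : ℤ) ^ e • t = 0 → A t = t →
      ∃ y : T, (2 : ℤ) ^ e • y = 0 ∧ t = y + A y)
    {ι : Type*} [Fintype ι] (π : ι → ι) (hπ : ∀ i, π (π i) = i)
    (e N : ι → ℕ) (hNe : ∀ i, N i ≤ e i) (heM : ∀ i, e i ≤ M) (hNπ : ∀ i, N (π i) = N i)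
    (κ : ι → T) (hκe : ∀ i, (2 : ℤ) ^ e i • κ i = 0) (hκA : ∀ i, A (κ (π i)) = κ i) :
    ∃ x : ι → T, (∀ i, (2 : ℤ) ^ e i • x i = 0) ∧
      ∀ i, (2 : ℤ) ^ N i • (κ i + A (x (π i)) + x i) = 0 ∧
        (N i ≠ 0 → (2 : ℤ) ^ (N i - 1) • (κ i + A (x (π i)) + x i) ≠ 0) := by
  have hndvd : ∀ {M : ℕ}, M ≠ 0 → ¬ (2 : ℤ) ^ M ∣ (2 : ℤ) ^ (M - 1) := fun {M} hM h ↦ by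
    have h1 : (2 : ℤ) ^ (M - 1) < (2 : ℤ) ^ M := pow_lt_pow_right₀ (by norm_num) (by omega)
    exact absurd (Int.le_of_dvd (by positivity) h) (not_le.mpr h1)
  have hAinj : Function.Injective A := fun s t h ↦ by rw [← hA2 s, h, hA2]
  have hAPM : (2 : ℤ) ^ M • A P = 0 := by rw [← map_zsmul, hPM, map_zero]
  have hsumM : (2 : ℤ) ^ M • (P + A P) = 0 := by rw [smul_add, hPM, hAPM, add_zero]
  have hP1' : M ≠ 0 → (2 : ℤ) ^ (M - 1) • P ≠ 0 := fun hM h ↦ hP1 hM (by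
    rw [smul_add, h, zero_add, ← map_zsmul, h, map_zero])
  have hAP1 : M ≠ 0 → (2 : ℤ) ^ (M - 1) • A P ≠ 0 := fun hM h ↦ hP1' hM (hAinj (by
    rw [map_zsmul, h, map_zero]))
  have hNM : ∀ i, N i ≤ M := fun i ↦ (hNe i).trans (heM i)
  -- the correcting elements at fixed points: `κ i = y i + A (y i)`, `2^{e i} y i = 0`
  have hfixA : ∀ i, π i = i → A (κ i) = κ i := fun i h ↦ by
    have := hκA i; rwa [h] at this
  have hy : ∀ i, ∃ y : T, π i = i → (2 : ℤ) ^ e i • y = 0 ∧ κ i = y + A y := fun i ↦ by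
    by_cases h : π i = i
    · obtain ⟨y, hy⟩ := hker (e i) (κ i) (heM i) (hκe i) (hfixA i h)
      exact ⟨y, fun _ ↦ hy⟩
    · exact ⟨0, fun h' ↦ absurd h' h⟩
  choose y hy using hy
  -- orbit representatives
  set enc : ι → ℕ := fun i ↦ (Fintype.equivFin ι i : ℕ) with henc
  have henc_inj : Function.Injective enc := fun i j h ↦
    (Fintype.equivFin ι).injective (Fin.ext h)
  set x : ι → T := fun i ↦
    if π i = i then (2 : ℤ) ^ (M - N i) • P - y i
    else if enc i ≤ enc (π i) then (2 : ℤ) ^ (M - N i) • P - κ i else 0 with hx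
  have hPe : ∀ i, (2 : ℤ) ^ e i • ((2 : ℤ) ^ (M - N i) • P) = 0 := fun i ↦ by
    rw [smul_smul, ← pow_add, show e i + (M - N i) = M + (e i - N i) by
      have := hNe i; have := heM i; omega, pow_add, mul_comm, mul_smul, hPM, smul_zero]
  refine ⟨x, fun i ↦ ?_, fun i ↦ ?_⟩
  · by_cases hfix : π i = i
    · simp only [hx, hfix, if_true]
      rw [smul_sub, hPe, (hy i hfix).1, sub_zero]
    · by_cases h : enc i ≤ enc (π i)
      · simp only [hx, hfix, h, if_true, if_false]
        rw [smul_sub, hPe, hκe, sub_zero]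
      · simp only [hx, hfix, h, if_false, smul_zero]
  · by_cases hfix : π i = i
    · -- fixed point: value `2^{M-N}(P + A P)`
      have hxi : x i = (2 : ℤ) ^ (M - N i) • P - y i := by simp only [hx, hfix, if_true]
      have hval : κ i + A (x (π i)) + x i = (2 : ℤ) ^ (M - N i) • (P + A P) := by
        rw [hfix, hxi, (hy i hfix).2, map_sub, map_zsmul, smul_add]
        abel
      rw [hval]
      exact zsmul_pow_sub_order (hNM i) hsumM fun hN0 ↦ hP1 (by have := hNM i; omega)
    · have hfix' : ¬ π (π i) = π i := by rw [hπ]; exact fun h ↦ hfix h.symm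
      by_cases h : enc i ≤ enc (π i)
      · -- representative: `x (π i) = 0`, value `2^{M-N} P`
        have hne : ¬ enc (π i) ≤ enc (π (π i)) := by
          rw [hπ]
          intro h'
          exact hfix (henc_inj (le_antisymm h' h))
        have hxπ : x (π i) = 0 := by simp only [hx, hfix', hne, if_false]
        have hxi : x i = (2 : ℤ) ^ (M - N i) • P - κ i := by simp only [hx, hfix, h, if_true, if_false]
        have hval : κ i + A (x (π i)) + x i = (2 : ℤ) ^ (M - N i) • P := by
          rw [hxπ, hxi, map_zero, add_zero]
          abel
        rw [hval]
        exact zsmul_pow_sub_order (hNM i) hPM fun hN0 ↦ hP1' (by have := hNM i; omega)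
      · -- `π i` is the representative: `x i = 0`, value `2^{M-N} A P` (using `κ (π i) … A κ`)
        have hle : enc (π i) ≤ enc (π (π i)) := by rw [hπ]; omega
        have hκ' : A (κ i) = κ (π i) := by
          have := hκA (π i); rwa [hπ] at this
        have hxπ : x (π i) = (2 : ℤ) ^ (M - N i) • P - κ (π i) := by
          simp only [hx, hfix', hle, if_true, if_false, hNπ]
        have hxi : x i = 0 := by simp only [hx, hfix, h, if_false]
        have hval : κ i + A (x (π i)) + x i = (2 : ℤ) ^ (M - N i) • A P := by
          rw [hxπ, hxi, add_zero, map_sub, map_zsmul, hκA i]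
          abel
        rw [hval]
        exact zsmul_pow_sub_order (hNM i) hAPM fun hN0 ↦ hAP1 (by have := hNM i; omega)

end StepBAlgebra

section StepBGalois

universe u v

variable {k : Type v} {K : Type u} [Field k] [Field K] [Algebra k K] (W : WeierstrassCurve k)
variable {σ : K ≃ₐ[k] K} {τ : AlgebraicClosure K ≃+* AlgebraicClosure K}

/-- With `ρ₀^τ ρ₀ ∈ Γ_{K(E[n])}` the two transports of `h₀` to `E(K̄)[n]` agree: `ρ₀⁻¹ ∘ τ = τ ∘ ρ₀`
(`A = A⁻¹`). [folklore] -/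
theorem inv_smul_torsionMap_eq_of_conjGal_mul_mem [W.IsElliptic] (hτ : IsLiftOfAut σ τ)
    (hinv : ∀ x, τ (τ x) = x) {n : ℤ} (ρ₀ : absoluteGaloisGroup K)
    (hk₀ : hτ.conjGalCMH ρ₀ * ρ₀ ∈ torsionFixing (W.baseChange K) n)
    (s : geomTorsion (W.baseChange K) n) :
    ρ₀⁻¹ • hτ.torsionMap W n s = hτ.torsionMap W n (ρ₀ • s) := by
  have h1 : hτ.torsionMap W n (ρ₀ • s) = hτ.conjGalCMH ρ₀ • hτ.torsionMap W n s := by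
    conv_lhs => rw [← hτ.conjGalCMH_conjGalCMH hinv ρ₀]
    rw [hτ.torsionMap_smul W n]
  have hmem : ρ₀ * hτ.conjGalCMH ρ₀ ∈ torsionFixing (W.baseChange K) n := by
    have := (torsionFixing_normal (W.baseChange K) n).conj_mem _ hk₀ ρ₀
    rwa [← mul_assoc, mul_inv_cancel_right] at this
  rw [h1, inv_smul_eq_iff, smul_smul, smul_eq_of_mem_torsionFixing _ n hmem]

/-- **McCallum's Galois element at `2` for a REGULAR element (card E2, PROVED).**  As the tree's
`exists_h1Eval_conj_mul_order_tauStable` (the case `ρ₀ = 1`, `Δ < 0`), but searching `ρ = ρ₀ · n`, `n ∈ Γ_{K(E[n])}`, for a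
FIXED `ρ₀ ∈ Γ_K` such that `k₀ := ρ₀^τ ρ₀ ∈ Γ_{K(E[n])}` (`h₀² = 1` on `E[n]`, `h₀ = c₀ · res ρ₀`); the involution `τ`
on `E[n]` is replaced by `A := ρ₀⁻¹ ∘ τ` (the action of `h₀`), the free pair `(P, τP)` by the LOSSLESS hypotheses
`hP1` (`P + A P` of order `2^M`) and `hker` (`ker(A - 1) = im(A + 1)` on `T[2^e]`), and the values are
`[c_i, (ρ m)^τ (ρ m)] = [c_i, k₀] + A [c_{π i}, n] + [c_i, n]` (`§H exists_orders_regular` absorbs the constant).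
Output: `n ∈ Γ_{K(E[n])}` with `ord [c_i, (ρ₀ n m)^τ (ρ₀ n m)] = 2^{N_i}` exactly for all `m ∈ 𝒩`, all `i` —
the hypothesis `hρ` of §F `exists_kolyvaginPrime_gt_two_of_galoisElement_regular` with `ρ := ρ₀ * n`.
[cite: McCallumLMS1991, §3 (2), Prop. 3.1, Cor. 3.2] [cite: GrossLMS1991, §9 Prop. 9.3] -/
theorem exists_h1Eval_conj_mul_order_regular [W.IsElliptic] (hτ : IsLiftOfAut σ τ)
    (hinv : ∀ x, τ (τ x) = x) {n : ℤ} (h2n : (2 : ℤ) ∣ n) {M : ℕ}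
    (hS : ∀ H : AddSubgroup (geomTorsion (W.baseChange K) 2),
      (∀ g : absoluteGaloisGroup K, ∀ t ∈ H, g • t ∈ H) → H = ⊥ ∨ H = ⊤)
    (hC : ∀ f : geomTorsion (W.baseChange K) 2 →+ geomTorsion (W.baseChange K) 2,
      (∀ (g : absoluteGaloisGroup K) (t : geomTorsion (W.baseChange K) 2), f (g • t) = g • f t) →
        ∃ c : ℤ, ∀ t, f t = c • t)
    (ρ₀ : absoluteGaloisGroup K)
    (hk₀ : hτ.conjGalCMH ρ₀ * ρ₀ ∈ torsionFixing (W.baseChange K) n)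
    {P : geomTorsion (W.baseChange K) n} (hPM : (2 : ℤ) ^ M • P = 0)
    (hP1 : M ≠ 0 → (2 : ℤ) ^ (M - 1) • (P + ρ₀⁻¹ • hτ.torsionMap W n P) ≠ 0)
    (hker : ∀ (e : ℕ) (t : geomTorsion (W.baseChange K) n), e ≤ M → (2 : ℤ) ^ e • t = 0 →
      ρ₀⁻¹ • hτ.torsionMap W n t = t →
        ∃ y : geomTorsion (W.baseChange K) n, (2 : ℤ) ^ e • y = 0 ∧ t = y + ρ₀⁻¹ • hτ.torsionMap W n y)
    {ι : Type*} [Fintype ι] {xs : ι → galH1Torsion (W.baseChange K) n} {π : ι → ι}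
    (hπ : ∀ i, π (π i) = i) (hxs : ∀ i, conjAct W σ n (xs i) = xs (π i))
    (e : ι → ℕ) (he : ∀ i, ((2 : ℤ) ^ e i) • xs i = 0)
    (hind : ∀ a : ι → ℤ, ∑ i, a i • xs i = 0 → ∀ i, ((2 : ℤ) ^ e i) ∣ a i)
    (hres : ∀ a : ι → ℤ, (∀ ρ ∈ torsionFixing (W.baseChange K) n,
      h1Eval (W.baseChange K) n (∑ i, a i • xs i) ρ = 0) → ∑ i, a i • xs i = 0)
    (Nv : ι → ℕ) (hNe : ∀ i, Nv i ≤ e i) (heM : ∀ i, e i ≤ M) (hNπ : ∀ i, Nv (π i) = Nv i) :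
    ∃ nn ∈ torsionFixing (W.baseChange K) n, ∀ m ∈ evalKer (W.baseChange K) n xs, ∀ i,
      ((2 : ℤ) ^ Nv i) • h1Eval (W.baseChange K) n (xs i)
          (hτ.conjGalCMH (ρ₀ * nn * m) * (ρ₀ * nn * m)) = 0 ∧
      (Nv i ≠ 0 →
        ((2 : ℤ) ^ (Nv i - 1)) • h1Eval (W.baseChange K) n (xs i)
          (hτ.conjGalCMH (ρ₀ * nn * m) * (ρ₀ * nn * m)) ≠ 0) := by
  set TF := torsionFixing (W.baseChange K) n with hTF
  set k₀ := hτ.conjGalCMH ρ₀ * ρ₀ with hk₀def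
  -- the involution `A = ρ₀⁻¹ ∘ τ` of `E[n]`
  have hτinv : ∀ s : geomTorsion (W.baseChange K) n,
      hτ.torsionMap W n (ρ₀⁻¹ • s) = (hτ.conjGalCMH ρ₀)⁻¹ • hτ.torsionMap W n s := fun s ↦ by
    rw [← map_inv, ← hτ.torsionMap_smul W n, hτ.conjGalCMH_conjGalCMH hinv]
  set A : geomTorsion (W.baseChange K) n →+ geomTorsion (W.baseChange K) n :=
    { toFun := fun s ↦ ρ₀⁻¹ • hτ.torsionMap W n s
      map_zero' := by rw [map_zero, smul_zero]
      map_add' := fun s t ↦ by rw [map_add, smul_add] } with hAdef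
  have hA : ∀ s, A s = ρ₀⁻¹ • hτ.torsionMap W n s := fun _ ↦ rfl
  have hA2 : ∀ t, A (A t) = t := fun t ↦ by
    rw [hA, hA, hτinv, hτ.torsionMap_torsionMap W hinv, smul_smul, ← mul_inv_rev,
      smul_eq_of_mem_torsionFixing _ n (inv_mem hk₀)]
  -- the constants `κ i = [c_i, k₀]`
  set κ : ι → geomTorsion (W.baseChange K) n := fun i ↦ h1Eval (W.baseChange K) n (xs i) k₀ with hκdef
  have hκe : ∀ i, (2 : ℤ) ^ e i • κ i = 0 := fun i ↦ by
    rw [hκdef]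
    simp only
    rw [← h1Eval_zsmul _ n _ _ hk₀, he i, h1Eval_zero _ n hk₀]
  have hconjk₀ : hτ.conjGalCMH k₀ = ρ₀ * k₀ * ρ₀⁻¹ := by
    rw [hk₀def, map_mul, hτ.conjGalCMH_conjGalCMH hinv, mul_assoc, mul_inv_cancel_right]
  have hκA : ∀ i, A (κ (π i)) = κ i := fun i ↦ by
    rw [hA, hκdef]
    simp only
    rw [← hxs i, hτ.h1Eval_conjAct W n (xs i) hk₀, hconjk₀, h1Eval_conj _ n _ ρ₀ hk₀,
      hτ.torsionMap_torsionMap W hinv, inv_smul_smul]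
  -- the targets (§H algebra) and their realisation as `([c_i, nn])_i` (Gross 9.3 / McCallum (2))
  obtain ⟨x, hxe, hx⟩ := exists_orders_regular A hA2 hPM hP1 hker π hπ e Nv hNe heM hNπ κ hκe hκA
  obtain ⟨nn, hnn, hnne⟩ := exists_h1Eval_eq_of_indep_of_res (W.baseChange K) Nat.prime_two h2n hS hC
    xs e he hind hres x hxe
  refine ⟨nn, hnn, fun m hm i ↦ ?_⟩
  have hnm : nn * m ∈ TF := mul_mem hnn hm.1
  have hconj_nm : hτ.conjGalCMH (nn * m) ∈ TF := hτ.conjGalCMH_mem_torsionFixing W hinv _ hnm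
  have hY : ρ₀⁻¹ * hτ.conjGalCMH (nn * m) * ρ₀⁻¹⁻¹ ∈ TF := (torsionFixing_normal _ n).conj_mem _ hconj_nm ρ₀⁻¹
  have hdecomp : hτ.conjGalCMH (ρ₀ * nn * m) * (ρ₀ * nn * m) =
      k₀ * ((ρ₀⁻¹ * hτ.conjGalCMH (nn * m) * ρ₀⁻¹⁻¹) * (nn * m)) := by
    rw [hk₀def, mul_assoc ρ₀ nn m, map_mul]
    group
  have hval : h1Eval (W.baseChange K) n (xs i) (hτ.conjGalCMH (ρ₀ * nn * m) * (ρ₀ * nn * m)) =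
      κ i + A (x (π i)) + x i := by
    rw [hdecomp, h1Eval_mul _ _ _ hk₀, h1Eval_mul _ _ _ hY, h1Eval_conj _ n _ ρ₀⁻¹ hconj_nm,
      h1Eval_conjGalCMH_of_tauStable W hτ hinv n hxs hnm, h1Eval_mul _ _ _ hnn, h1Eval_mul _ _ _ hnn,
      hnne i, hnne (π i), hm.2 i, hm.2 (π i), add_zero, add_zero, hA, add_assoc]
  rw [hval]
  exact hx i

end StepBGalois

section StepBRat

open scoped Pointwise
open NumberField Literature.NumberTheory.GaloisRepresentations Literature.NumberTheory

universe u

variable {W : WeierstrassCurve ℚ} {K : Type u} [Field K] [NumberField K]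

/-- ℚ-side `h₀² = 1` on `E(ℚ̄)[n]` (`h₀ = c₀ · res ρ`) ⇒ K-side `ρ^τ ρ ∈ Γ_{K(E[n])}` (hypothesis `hk₀` of
`exists_h1Eval_conj_mul_order_regular`; transport along `E(ℚ̄)[n] ≃ E(K̄)[n]` and
`(c₀ res ρ)² = res (ρ^τ ρ)`). [folklore] [cite: GrossLMS1991, §3] -/
theorem conjGal_mul_mem_torsionFixing_of_smul_smul {c₀ : absoluteGaloisGroup ℚ}
    (hc₀ : IsComplexConjugation (Rat.castHom ℝ) c₀) {c : K ≃ₐ[ℚ] K}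
    (ht : IsLiftOfAut c (absGaloisTransport (K := ℚ) (L := K) c₀).toRingEquiv) {n : ℤ}
    (ρ : absoluteGaloisGroup K)
    (hsq : ∀ P : geomTorsion W n,
      (c₀ * absGaloisRestrict ℚ K ρ) • (c₀ * absGaloisRestrict ℚ K ρ) • P = P) :
    ht.conjGalCMH ρ * ρ ∈ torsionFixing (W.baseChange K) n := by
  refine (mem_torsionFixing_iff _ _).mpr fun Q ↦ ?_
  obtain ⟨P, rfl⟩ := (RatClosure.torsionEquiv (K := K) W n).surjective Q
  rw [← RatClosure.torsionEquiv_smul, ← sq_eq_absGaloisRestrict_conjGal_mul hc₀ ht ρ, pow_two,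
    mul_smul, hsq]

/-- Right-multiplying `ρ` by an element of `Γ_{K(E[n])}` does not change the action of `c₀ · res ρ` on `E(ℚ̄)[n]`.
[folklore] -/
theorem mul_absGaloisRestrict_mul_smul_eq {n : ℤ} (c₀ : absoluteGaloisGroup ℚ)
    {ρ nn : absoluteGaloisGroup K} (hnn : nn ∈ torsionFixing (W.baseChange K) n)
    (P : geomTorsion W n) :
    (c₀ * absGaloisRestrict ℚ K (ρ * nn)) • P = (c₀ * absGaloisRestrict ℚ K ρ) • P := by
  rw [map_mul, ← mul_assoc, mul_smul (c₀ * _), absGaloisRestrict_smul_eq_of_mem_torsionFixing W hnn]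

/-- **Step B for a REGULAR element, ℚ-side packaging (card E2, PROVED).**  `K` imaginary quadratic, `c₀` a
complex conjugation with transport `t = e c₀ e⁻¹` lifting `c ≠ 1`, `n = 2^M`; `ρ₀ ∈ Γ_K` with `h₀ := c₀ · res ρ₀`
satisfying, on `E(ℚ̄)[2^M]`: `h₀² = 1` (`hsq`), a point `P` with `P + h₀ P` of order `2^M` (`hP1`, LOSSLESS), and
`ker(h₀ - 1) = im(h₀ + 1)` on each `E[2^e]`, `e ≤ M` (`hker`, regularity; both are R1/LKL of the lead's
`…RegularFilterAlgebra`).  Then for `t`-stable classes `cs` (as in the tree chain) there is `ρ ∈ Γ_K` with the SAME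
action `c₀ · res ρ = h₀` on `E(ℚ̄)[2^M]` (so `hsq`, and `hμ` of §F, transfer verbatim from `ρ₀`) and exact orders
`ord [c_i, (ρ m)^t (ρ m)] = 2^{N_i}` for all `m ∈ 𝒩` — precisely the hypothesis `hρ` of §F
`exists_kolyvaginPrime_gt_two_of_galoisElement_regular`.  [cite: McCallumLMS1991, §3 (2), Prop. 3.1]
[cite: GrossLMS1991, §9 Prop. 9.3] -/
theorem exists_galoisElement_regular_rat [W.IsElliptic] (hK : IsImaginaryQuadratic K) {M : ℕ}
    (hM : 1 ≤ M) {c₀ : absoluteGaloisGroup ℚ} (hc₀ : IsComplexConjugation (Rat.castHom ℝ) c₀)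
    {c : K ≃ₐ[ℚ] K} (hc : c ≠ 1)
    (hS : ∀ H : AddSubgroup (geomTorsion (W.baseChange K) 2),
      (∀ g : absoluteGaloisGroup K, ∀ t ∈ H, g • t ∈ H) → H = ⊥ ∨ H = ⊤)
    (hC : ∀ f : geomTorsion (W.baseChange K) 2 →+ geomTorsion (W.baseChange K) 2,
      (∀ (g : absoluteGaloisGroup K) (t : geomTorsion (W.baseChange K) 2), f (g • t) = g • f t) →
        ∃ c : ℤ, ∀ t, f t = c • t)
    (ρ₀ : absoluteGaloisGroup K)
    (hsq : ∀ X : geomTorsion W ((2 ^ M : ℕ) : ℤ),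
      (c₀ * absGaloisRestrict ℚ K ρ₀) • (c₀ * absGaloisRestrict ℚ K ρ₀) • X = X)
    {P : geomTorsion W ((2 ^ M : ℕ) : ℤ)}
    (hP1 : M ≠ 0 → (2 : ℤ) ^ (M - 1) • (P + (c₀ * absGaloisRestrict ℚ K ρ₀) • P) ≠ 0)
    (hker : ∀ (e : ℕ) (X : geomTorsion W ((2 ^ M : ℕ) : ℤ)), e ≤ M → (2 : ℤ) ^ e • X = 0 →
      (c₀ * absGaloisRestrict ℚ K ρ₀) • X = X →
        ∃ Y : geomTorsion W ((2 ^ M : ℕ) : ℤ), (2 : ℤ) ^ e • Y = 0 ∧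
          X = Y + (c₀ * absGaloisRestrict ℚ K ρ₀) • Y)
    {ι : Type*} [Fintype ι] {cs : ι → galH1Torsion (W.baseChange K) ((2 ^ M : ℕ) : ℤ)} {π : ι → ι}
    (hπ : ∀ i, π (π i) = i) (hcs : ∀ i, conjAct W c ((2 ^ M : ℕ) : ℤ) (cs i) = cs (π i))
    (e : ι → ℕ) (he : ∀ i, ((2 : ℤ) ^ e i) • cs i = 0)
    (hind : ∀ a : ι → ℤ, ∑ i, a i • cs i = 0 → ∀ i, ((2 : ℤ) ^ e i) ∣ a i)
    (hres : ∀ a : ι → ℤ, (∀ ρ ∈ torsionFixing (W.baseChange K) ((2 ^ M : ℕ) : ℤ),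
      h1Eval (W.baseChange K) ((2 ^ M : ℕ) : ℤ) (∑ i, a i • cs i) ρ = 0) → ∑ i, a i • cs i = 0)
    (Nv : ι → ℕ) (hNe : ∀ i, Nv i ≤ e i) (heM : ∀ i, e i ≤ M) (hNπ : ∀ i, Nv (π i) = Nv i) :
    ∃ ρ : absoluteGaloisGroup K,
      (∀ X : geomTorsion W ((2 ^ M : ℕ) : ℤ),
        (c₀ * absGaloisRestrict ℚ K ρ) • X = (c₀ * absGaloisRestrict ℚ K ρ₀) • X) ∧
      (∀ X : geomTorsion W ((2 ^ M : ℕ) : ℤ),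
        (c₀ * absGaloisRestrict ℚ K ρ) • (c₀ * absGaloisRestrict ℚ K ρ) • X = X) ∧
      ∀ m ∈ evalKer (W.baseChange K) ((2 ^ M : ℕ) : ℤ) cs, ∀ i,
        ((2 : ℤ) ^ Nv i) • h1Eval (W.baseChange K) ((2 ^ M : ℕ) : ℤ) (cs i)
            ((RatClosure.isLiftOfAut_absGaloisTransport_of_isImaginaryQuadratic hK hc hc₀).conjGalCMH
              (ρ * m) * (ρ * m)) = 0 ∧
          (Nv i ≠ 0 → ((2 : ℤ) ^ (Nv i - 1)) • h1Eval (W.baseChange K) ((2 ^ M : ℕ) : ℤ) (cs i)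
            ((RatClosure.isLiftOfAut_absGaloisTransport_of_isImaginaryQuadratic hK hc hc₀).conjGalCMH
              (ρ * m) * (ρ * m)) ≠ 0) := by
  classical
  have h2n : (2 : ℤ) ∣ ((2 ^ M : ℕ) : ℤ) := by
    rw [Nat.cast_pow]; exact dvd_pow_self _ (by omega)
  set t : AlgebraicClosure K ≃+* AlgebraicClosure K :=
    (absGaloisTransport (K := ℚ) (L := K) c₀).toRingEquiv with ht_def
  have ht : IsLiftOfAut c t :=
    RatClosure.isLiftOfAut_absGaloisTransport_of_isImaginaryQuadratic hK hc hc₀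
  have hinv : ∀ x, t (t x) = x := fun x ↦
    RatClosure.absGaloisTransport_absGaloisTransport_of_sq_eq_one hc₀.sq_eq_one x
  have hk₀ : ht.conjGalCMH ρ₀ * ρ₀ ∈ torsionFixing (W.baseChange K) ((2 ^ M : ℕ) : ℤ) :=
    conjGal_mul_mem_torsionFixing_of_smul_smul hc₀ ht ρ₀ hsq
  set eq := RatClosure.torsionEquiv (K := K) W ((2 ^ M : ℕ) : ℤ) with heq
  -- the transport of `h₀`: `eq (h₀ X) = τ (ρ₀ • eq X) = ρ₀⁻¹ • τ (eq X)`
  have hB : ∀ X : geomTorsion W ((2 ^ M : ℕ) : ℤ), eq ((c₀ * absGaloisRestrict ℚ K ρ₀) • X) =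
      ρ₀⁻¹ • ht.torsionMap W ((2 ^ M : ℕ) : ℤ) (eq X) := fun X ↦ by
    rw [mul_smul, heq, RatClosure.torsionEquiv_smul_of_lift W ht c₀ (fun _ ↦ rfl),
      RatClosure.torsionEquiv_smul, inv_smul_torsionMap_eq_of_conjGal_mul_mem W ht hinv ρ₀ hk₀]
  have hT : ∀ Q : geomTorsion (W.baseChange K) ((2 ^ M : ℕ) : ℤ), (2 : ℤ) ^ M • Q = 0 := fun Q ↦ by
    have h := (mem_geomTorsion_iff _ ((2 ^ M : ℕ) : ℤ) _).mp Q.2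
    have hc : (2 : ℤ) ^ M = ((2 ^ M : ℕ) : ℤ) := by push_cast; rfl
    apply Subtype.ext
    rw [AddSubgroupClass.coe_zsmul, ZeroMemClass.coe_zero, hc]
    exact h
  have hPM : (2 : ℤ) ^ M • eq P = 0 := hT _
  have hP1' : M ≠ 0 →
      (2 : ℤ) ^ (M - 1) • (eq P + ρ₀⁻¹ • ht.torsionMap W ((2 ^ M : ℕ) : ℤ) (eq P)) ≠ 0 := by
    intro hM0 h
    rw [← hB, ← map_add, ← map_zsmul, map_eq_zero_iff _ eq.injective] at h
    exact hP1 hM0 h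
  have hker' : ∀ (d : ℕ) (s : geomTorsion (W.baseChange K) ((2 ^ M : ℕ) : ℤ)), d ≤ M →
      (2 : ℤ) ^ d • s = 0 → ρ₀⁻¹ • ht.torsionMap W ((2 ^ M : ℕ) : ℤ) s = s →
        ∃ y : geomTorsion (W.baseChange K) ((2 ^ M : ℕ) : ℤ), (2 : ℤ) ^ d • y = 0 ∧
          s = y + ρ₀⁻¹ • ht.torsionMap W ((2 ^ M : ℕ) : ℤ) y := by
    intro d s hd hds hfix
    obtain ⟨X, rfl⟩ := eq.surjective s
    rw [← hB, eq.injective.eq_iff] at hfix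
    rw [← map_zsmul, map_eq_zero_iff _ eq.injective] at hds
    obtain ⟨Y, hY, hXY⟩ := hker d X hd hds hfix
    refine ⟨eq Y, by rw [← map_zsmul, hY, map_zero], ?_⟩
    rw [← hB, ← map_add, ← hXY]
  obtain ⟨nn, hnn, H⟩ := exists_h1Eval_conj_mul_order_regular W ht hinv h2n hS hC ρ₀ hk₀ hPM hP1'
    hker' hπ hcs e he hind hres Nv hNe heM hNπ
  refine ⟨ρ₀ * nn, fun X ↦ mul_absGaloisRestrict_mul_smul_eq c₀ hnn X, fun X ↦ ?_, H⟩
  rw [mul_absGaloisRestrict_mul_smul_eq c₀ hnn, mul_absGaloisRestrict_mul_smul_eq c₀ hnn, hsq]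

end StepBRat

end StepBH

end Summit.BirchSwinnertonDyer.BirchSwinnertonDyer.Theorems.OffBigImageOddLocalAtTwo.Engine

end
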